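import Literature.AlgebraicGeometry.Motives.ChowCorrespondences
import HarnessLib

/-!
# Ayoub's conservativity conjecture, in the fragment for Chow motives (a named PREDICATE; open)

Cite item `wi-19910` (route HodgeConjecture/ConservativityLefschetz, item `ConservativityChow`: the
route's conditional header `(h : AyoubConservativity C W)`). The tree already renders Ayoub's
Conjecture 2.1 restricted to Chow motives as the predicate `ChowMotive.IsConservativeOn C W 𝒯`
(file `ChowCorrespondences`, with the verbatim quotation of Ayoub 2017 §2.1); this file only gives
the full-subcategory case `𝒯 = Set.univ` its NAME, records the STATUS of the conjecture with its
sources, and proves the unfoldings the route consumes. Sources read this session: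

* J. Ayoub, *Motives and algebraic cycles: a selection of conjectures and open questions* (2017),
  §2.1, **Conjecture 2.1**: "The Betti realisation functor `B_σ : DM_gm(k; Λ) → D(Λ)` is
  conservative" (`k` of characteristic `0`, `σ : k ↪ ℂ`; conservative: "a morphism `α : A → B`
  […] is an isomorphism if and only if `f(α)` is an isomorphism"), used for Chow motives in the
  proof of Prop. 2.17 (quoted in `ChowMotive.IsConservativeOn`). The conjecture goes back to
  J. Ayoub, *The motivic vanishing cycles and the conservation conjecture*, in *Algebraic Cycles
  and Motives* I, LMS LNS 343 (2007) [Ayoub2007].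
* M. Bondarko, *Conservativity of realizations implies that numerical motives are Kimura-finite
  and motivic zeta functions are rational*, arXiv:1807.10791 [Bondarko2018Conservativity]:
  Assumption 1 ("the functor `RH_{ét,ℚ_l}` is conservative, i.e., an object `M` of `DM_gm` is zero
  whenever `RH(M) = 0`. Recall that this statement is conjecturally valid for arbitrary base
  fields"); **Prop. 5.3** ("Assume that `p = char k = 0`. Then Assumption 1 is fulfilled if and only
  if the naturally defined De Rham realization […] is conservative on `DM_gm`" — in characteristic
  `0` the conservativity of the étale, de Rham and (for `k ⊆ ℂ`, via Huber's mixed realisation)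
  Betti realisations are equivalent); **Remark 5.4 (1)**: "the recent proof of the conservativity of
  the restriction of `RH_dR` to the category `Chow` in the case `p = 0`; see Theorem I of [Ayoub,
  *Topologie feuilletée et la conservativité des réalisations classiques en caractéristique nulle*,
  preprint 2018] (unfortunately, the current version of this proof contains a gap). Certainly, this
  statement implies the seminal Bloch conjecture"; and the title theorems (conservativity ⇒
  numerical motives are Kimura-finite; motivic zeta functions are rational).

**STATUS: OPEN** (as of the sources above: announced proof with a gap). Accordingly nothing is
asserted here: `ChowMotive.AyoubConservativity C W` is a `Prop`-valued DEFINITION with parameters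
(the calculus of correspondences `C` and the Weil cohomology theory `W`), to be taken as a
hypothesis. The conjecture proper is the instance `k ⊆ ℂ` of characteristic `0`, `W` the Betti
theory (`B.W` of a `BettiHodgeData`), `C` the genuine calculus of Fulton §16.1 (an inhabitant of
the interface `ChowCorrespondences k` compatible with `W`, `C.Realisation W`); because that
interface does not pin composition of arbitrary correspondences, the CLOSED statement
"`∀ C, AyoubConservativity C W`" would be stronger than what Ayoub conjectures and is deliberately
NOT introduced as a named fact.

## References

* [Ayoub2017Conjectures] J. Ayoub, Motives and algebraic cycles: a selection of conjectures and
  open questions, in: Hodge theory and `L²`-analysis, ALM 39 (2017), §2.1 Conj. 2.1, Prop. 2.17.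
* [Ayoub2007] J. Ayoub, The motivic vanishing cycles and the conservation conjecture, in: Algebraic
  Cycles and Motives, Vol. 1, LMS Lecture Note Ser. 343, CUP 2007, 3–54.
* [Bondarko2018Conservativity] M. V. Bondarko, arXiv:1807.10791 (2018), Assumption 1, Prop. 5.3,
  Remark 5.4.
-/

noncomputable section

namespace Literature.AlgebraicGeometry.Motives

universe u v

variable {k : Type u} [Field k] {K : Type v} [Field K] [CharZero K]

namespace ChowMotive

/-- **Ayoub's conservativity conjecture for Chow motives** (Ayoub 2017, Conj. 2.1, in the fragment
`CHM(k)_ℚ ↪ DM_gm(k; ℚ)`; Ayoub 2007), for the calculus of correspondences `C` realised in the Weil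
cohomology theory `W`: EVERY morphism of Chow motives `f : (X, p, m) → (Y, q, n)` whose realisation
`H(f) : H(M) → H(N)` is an isomorphism is an isomorphism in `CHM(k)_ℚ` — i.e.
`ChowMotive.IsConservativeOn C W Set.univ`. A hypothesis, not a theorem: STATUS OPEN (announced
foliated-topology proof of the Chow case in characteristic `0` "contains a gap", Bondarko 2018
Rem. 5.4 (1)); in characteristic `0` the Betti / de Rham / étale versions are equivalent (Bondarko
Prop. 5.3) and imply Kimura-finiteness of numerical motives and Bloch's conjecture.
[cite: Ayoub2017Conjectures, §2.1 Conj. 2.1] [cite: Ayoub2007, Introduction (conservation conjecture)]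
[cite: Bondarko2018Conservativity, Prop. 5.3 and Remark 5.4] -/
def AyoubConservativity (C : ChowCorrespondences k) (W : WeilCohomology k K) : Prop :=
  IsConservativeOn C W Set.univ

variable {C : ChowCorrespondences k} {W : WeilCohomology k K}

/-- Conservativity on all Chow motives gives conservativity on every family `𝒯`.
[cite: Ayoub2017Conjectures, §2.1 Conj. 2.1] -/
theorem AyoubConservativity.isConservativeOn (h : AyoubConservativity C W) (𝒯 : Set (ChowMotive C)) :
    IsConservativeOn C W 𝒯 :=
  fun _ _ _ _ _ _ hce he f hf hinv ↦ h (Set.mem_univ _) (Set.mem_univ _) hce he f hf hinv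

/-- Conservativity is antitone in the family of motives. [cite: Ayoub2017Conjectures, §2.1] -/
theorem IsConservativeOn.mono {𝒯 𝒯' : Set (ChowMotive C)} (h : IsConservativeOn C W 𝒯')
    (h𝒯 : 𝒯 ⊆ 𝒯') : IsConservativeOn C W 𝒯 :=
  fun _ _ hM hN _ _ hce he f hf hinv ↦ h (h𝒯 hM) (h𝒯 hN) hce he f hf hinv

/-- **The consequence consumed by route ConservativityLefschetz (`ConservativityChow`)**: under
Ayoub's conjecture, a morphism of Chow motives `f ∈ q ∘ Corr(X, Y) ∘ p` with invertible realisation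
has an inverse `g ∈ p ∘ Corr(Y, X) ∘ q`, `g ∘ f = p = id_M`, `f ∘ g = q = id_N` (Ayoub 2017, proof
of Prop. 2.17: "`B_σ(β)` is an isomorphism. Applying Conjecture 2.1, we deduce that `β` was already
an isomorphism"). [cite: Ayoub2017Conjectures, proof of Prop. 2.17] -/
theorem AyoubConservativity.exists_inverse (h : AyoubConservativity C W) {M N : ChowMotive C}
    {c e : ℕ} (hce : c + e = M.dim + N.dim) (he : M.HomDegree N e) {f : Corr M.X N.X e}
    (hf : f ∈ M.homSpace N e) (hinv : M.IsRealisationInvertible W N hce f) :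
    ∃ (e' : ℕ) (he' : N.HomDegree M e'), ∃ g ∈ N.homSpace M e',
      C.comp N.dim (show e + e' = M.dim + N.dim by unfold HomDegree at he he'; omega) g f = M.proj ∧
        C.comp M.dim (show e' + e = N.dim + M.dim by unfold HomDegree at he he'; omega) f g =
          N.proj :=
  h (Set.mem_univ M) (Set.mem_univ N) hce he f hf hinv

end ChowMotive

end Literature.AlgebraicGeometry.Motives

end
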